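import Literature.Algebra.Homology.OrderedCechSystemAugment
import Literature.Algebra.Homology.OrderedCechPairSystemBounds
import Literature.Algebra.Homology.BicomplexSingleRow
import Literature.Algebra.Homology.TotalQuasiIsoOfBoundedColumns
import HarnessLib

/-!
# The column augmentation of the ordered Čech bicomplex of a pair-system and `Č•(P(·, ∅)) ⟶ Tot Č•,•(P)` (Stacks 0BEC, 01FG, 0133)

Layer `Literature/Algebra/Homology` (constructions + proved lemmas; 0 named facts, no instance, no notation; pure homological
algebra over a commutative ring `A`). For a pair-system `P : Finset ι ⥤ Finset κ ⥤ ModuleCat A` (`Algebra/Homology/OrderedCechPairSystem`)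
the members `P(s, ∅)` at the EMPTY second index (geometrically `Γ(G, p⁻¹U_s)`, since `V_∅ = Y`) form an `ι`-system
`P(·, ∅) = P.flip.obj ∅` which the bicomplex `Č•,•(P)` never uses; its ordered Čech cochains `Čᵃ(P(·, ∅))` ARE the empty members
of the `κ`-systems `cochainSystem P a` (`rfl`), so the augmentation of `Algebra/Homology/OrderedCechSystemAugment` gives, column by
column,

* **`sysBicomplexAugment P : singleRowBicomplex (Č•(P(·, ∅))) ⟶ Č•,•(P)`** — the morphism of bicomplexes whose column `a` is
  `sysAugmentHom (cochainSystem P a) : Čᵃ(P(·, ∅))[0] ⟶ Č•(cochainSystem P a)` (outer squares: naturality of the augmentation at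
  the `σ`-differential `cochainSystemD P a`); `sysBicomplexAugment_f` (`rfl`);
* **`toTotal P : Č•(P(·, ∅)) ⟶ Tot Č•,•(P)`** — composed with `Č•(P(·, ∅)) ≅ Tot(Č•(P(·, ∅))[0])`
  (`Algebra/Homology/BicomplexSingleRow.ιTotalSingleRow`);
* **`quasiIso_toTotal_of_quasiIso_columns`** — if every column augmentation `Čᵃ(P(·, ∅))[0] ⟶ Č•(cochainSystem P a)` is a
  quasi-isomorphism (i.e. each `κ`-system `t ↦ Čᵃ(P(·, t))` is Čech-resolved by its empty member), then `toTotal P` is a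
  quasi-isomorphism: a column-wise quasi-isomorphism of first-quadrant bicomplexes (`Algebra/Homology/OrderedCechPairSystemBounds`,
  `BicomplexSingleRow`) induces one on total complexes (`TotalQuasiIsoOfBoundedColumns.quasiIso_total_map_of_quasiIso_columns_of_isStrictlyGE`,
  Weibel 5.6; Stacks 0133).

This is the algebraic skeleton of «the Čech complex of a cover with coefficients in the Čech resolutions of a second cover maps
quasi-isomorphically to the double complex» (The Stacks Project, Tag 0BEC / 01FP pattern); no scheme, sheaf or cohomology statement
is made here. Library only (cell `pub-hodge-ring2`, count-neutral); proves nothing about any crux, route or conjecture. Mathlib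
searched (pin v4.32): `CochainComplex.ofHom`, `HomologicalComplex₂.total.map`, `quasiIso_comp` instances (used).

## References

* The Stacks Project, Tag 0BEC (Künneth: the double Čech complex), Tag 01FG / 01FP (Čech complexes), Tag 0133 (double complexes
  with exact columns). [StacksProject]
* C. A. Weibel, *An introduction to homological algebra* (1994), 5.6.1–5.6.2, 2.7.3. [Weibel1994]
* U. Görtz, T. Wedhorn, *Algebraic Geometry II* (2023), Lemma 21.65, Def. 21.68, Lemma 21.75 (pp. 179–180, 264). [GortzWedhorn2023]
-/

universe u

open CategoryTheory HomologicalComplex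

set_option backward.isDefEq.respectTransparency false

noncomputable section

namespace Literature.Algebra.Homology

namespace OrderedCech

variable {A : Type u} [CommRing A] {ι κ : Type} [LinearOrder ι] [LinearOrder κ]
  (P : Finset ι ⥤ Finset κ ⥤ ModuleCat.{u} A)

/-! ### §1 The empty members of the `κ`-systems of `σ`-cochains -/

omit [LinearOrder κ] in
/-- `(cochainSystem P a) ∅ = Čᵃ(P(·, ∅))` (`rfl`): the empty member of the `κ`-system of `σ`-cochains is the module of
`a`-cochains of the `ι`-system `P(·, ∅) = P.flip.obj ∅`. [cite: StacksProject, Tag 0BEC] -/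
theorem cochainSystem_obj_empty (a : ℤ) :
    (cochainSystem P a).obj ∅ = ModuleCat.of A (SysCochain (P.flip.obj ∅) a) := rfl

omit [LinearOrder κ] in
/-- The `σ`-differential of the `κ`-systems at the empty member is the Čech differential of `P(·, ∅)` (`rfl`).
[cite: GortzWedhorn2023, Def. 21.68 (p. 180)] -/
theorem cochainSystemD_app_empty (a : ℤ) :
    (cochainSystemD P a).app ∅ = ModuleCat.ofHom (sysD (P.flip.obj ∅) a) := rfl

/-! ### §2 The augmentation of the bicomplex by the Čech complex of `P(·, ∅)` -/

/-- **`Č•(P(·, ∅))[0] ⟶ Č•,•(P)`**: the morphism of bicomplexes whose column `a` is the augmentation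
`Čᵃ(P(·, ∅))[0] ⟶ Č•(cochainSystem P a)` of the `κ`-system of `σ`-cochains by its empty member
(`OrderedCechSystemAugment.sysAugmentHom`); the squares with the outer (`σ`-) differentials commute by the naturality of the
augmentation (`sysAugmentHom_naturality` at `cochainSystemD P a`). [cite: StacksProject, Tag 0BEC] [cite: GortzWedhorn2023, Lemma 21.75 (p. 264)] -/
def sysBicomplexAugment : singleRowBicomplex (sysComplex (P.flip.obj ∅)) ⟶ sysBicomplex P :=
  CochainComplex.ofHom (fun a => sysAugmentHom (cochainSystem P a)) fun a => by
    rw [sysBicomplex_d, ← sysAugmentHom_naturality (cochainSystemD P a)]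
    congr 1
    change _ = (single (ModuleCat.{u} A) (ComplexShape.up ℤ) 0).map ((sysComplex (P.flip.obj ∅)).d a (a + 1))
    rw [sysComplex_d]
    rfl

/-- The columns of `sysBicomplexAugment` (`rfl`). [cite: StacksProject, Tag 0BEC] -/
@[simp] theorem sysBicomplexAugment_f (a : ℤ) : (sysBicomplexAugment P).f a = sysAugmentHom (cochainSystem P a) := rfl

/-- The degree-`(a, 0)` component on elements: `g ↦ (τ ↦ (σ ↦ P(∅ ⊆ τ)_σ (g σ)))` — the augmentation `ε` of
`cochainSystem P a` (up to `singleObjXSelf`). [cite: GortzWedhorn2023, Lemma 21.65 (p. 179)] -/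
theorem sysBicomplexAugment_f_f_zero (a : ℤ) :
    ((sysBicomplexAugment P).f a).f 0 =
      (singleObjXSelf (ComplexShape.up ℤ) 0 ((cochainSystem P a).obj ∅)).hom ≫
        ModuleCat.ofHom (sysAugment (cochainSystem P a)) :=
  sysAugmentHom_f_zero _

/-! ### §3 `Č•(P(·, ∅)) ⟶ Tot Č•,•(P)` and the column criterion -/

/-- **`Č•(P(·, ∅)) ⟶ Tot Č•,•(P)`**: the Čech complex of the `∅`-column system maps to the total complex of the bicomplex
(`Č•(P(·, ∅)) ≅ Tot(Č•(P(·, ∅))[0])` of `BicomplexSingleRow`, then `Tot` of `sysBicomplexAugment`).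
[cite: StacksProject, Tag 0BEC] [cite: GortzWedhorn2023, Lemma 21.75 (p. 264)] -/
def toTotal : sysComplex (P.flip.obj ∅) ⟶ (sysBicomplex P).total (ComplexShape.up ℤ) :=
  ιTotalSingleRow (sysComplex (P.flip.obj ∅)) ≫
    HomologicalComplex₂.total.map (sysBicomplexAugment P) (ComplexShape.up ℤ)

/-- **`Tot` of the augmentation is a quasi-isomorphism when every column augmentation is**: a column-wise quasi-isomorphism
between first-quadrant bicomplexes (columns `≥ 0` by `isStrictlyGE_singleRowBicomplex` / `isStrictlyGE_sysBicomplex`, every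
column in degrees `≥ 0`) induces a quasi-isomorphism of total complexes. [cite: StacksProject, Tag 0133] [cite: Weibel1994, 5.6.1–5.6.2] -/
theorem quasiIso_total_map_sysBicomplexAugment (h : ∀ a : ℤ, QuasiIso (sysAugmentHom (cochainSystem P a))) :
    QuasiIso (HomologicalComplex₂.total.map (sysBicomplexAugment P) (ComplexShape.up ℤ)) := by
  haveI : CochainComplex.IsStrictlyGE (sysComplex (P.flip.obj ∅)) 0 := isStrictlyGE_sysComplex _
  haveI := isStrictlyGE_singleRowBicomplex (sysComplex (P.flip.obj ∅)) 0
  haveI := isStrictlyGE_sysBicomplex P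
  exact quasiIso_total_map_of_quasiIso_columns_of_isStrictlyGE _ _ (sysBicomplexAugment P) 0 0
    (fun a => isStrictlyGE_singleRowBicomplex_X _ a) (fun a => isStrictlyGE_sysBicomplex_X P a) fun a => h a

/-- **`Č•(P(·, ∅)) ⟶ Tot Č•,•(P)` is a quasi-isomorphism as soon as every column augmentation
`Čᵃ(P(·, ∅))[0] ⟶ Č•(cochainSystem P a)` is** (i.e. each `κ`-system `t ↦ Čᵃ(P(·, t))` is Čech-resolved by its empty member).
[cite: StacksProject, Tag 0BEC] [cite: StacksProject, Tag 0133] [cite: GortzWedhorn2023, Lemma 21.75 (p. 264)] -/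
theorem quasiIso_toTotal_of_quasiIso_columns (h : ∀ a : ℤ, QuasiIso (sysAugmentHom (cochainSystem P a))) :
    QuasiIso (toTotal P) := by
  haveI := isIso_ιTotalSingleRow (sysComplex (P.flip.obj ∅))
  haveI := quasiIso_total_map_sysBicomplexAugment P h
  unfold toTotal
  infer_instance

end OrderedCech

end Literature.Algebra.Homology

end
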